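import Summits.Ventures.HodgeRepro.Night1LoadBearing
import Summits.Ventures.HodgeRepro.Night1ProductDischarge

/-!
# Which clause is load-bearing in the reduction-free discharge? — all eight of `ProdClauses`, and the two
numerical hypotheses `g ≤ p` and `3k ≤ p`

Blind re-derivation cell `pub-hodge-repro`, seat `night-1` (gen 2).  `Night1ProductDischarge.routeC_closes_product`
derives `WeilAlgebraic T` for a `SumP k` corner family `T` from the bundle `ProdClauses p k` (the seven clauses of
`Clauses` other than Lemma R, plus the printed Weil-line clause `WeilLine_Hodge`) under `g = |ι| · |G| / 2 ≤ p` and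
`3k ≤ p`.  This file shows, in the style of `Night1LoadBearing.lean` (whose counter-vocabularies `LoadBearing.mk`
it reuses), that NOTHING can be dropped:

* each of the eight clauses is logically independent of the other seven over the conclusion (`*_independent`:
  a vocabulary in which the other seven hold and the clause and every Weil line fail);
* **the dimension bound is load-bearing** (`dim_load_bearing`): for every `SumP` family `T` with `|ι| · |G| / 2 > p`
  there is a vocabulary satisfying ALL EIGHT clauses at `(p, k)` in which `W_F(B)` is not algebraic — so the
  reduction-free route cannot run below `p = dim B`, and the value of Lemma R on a face is exactly the drop
  `dim B − dim B_red` (`face_needs_lemmaR_below_two_card`: on a degree-8 face `ProdClauses 6 2` does not discharge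
  what `Clauses 6 2` discharges through Lemma R — `RouteCFaceC2C2C2Discharge`);
* **BMM's range is load-bearing** (`range_load_bearing`): for `p < 3k < 2p` all eight clauses can hold at `(p, k)`
  with no Weil line algebraic.

The counter-vocabularies are built on `ℕ` as in `Night1LoadBearing.lean` (codes `0` = the ball quotient, `7` =
Liu's `A_μ`, `3` = a simple factor, `card J` or the dimension sum = the product of `J` factors); nothing
geometric is asserted.  Nothing here says anything about the status of the Hodge conjecture for CM abelian
varieties, which is NOT proved.
-/

set_option autoImplicit false

open Finset
open scoped Pointwise

namespace HodgeRepro.RouteC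

namespace LoadBearing

variable {G : Type} [Group G] [DecidableEq G] [Fintype G] {c : G}

/-- The dimension sum of a family of representatives, `Σ_k |G| / (2 |rstab (Φ k)|)` — R5's `dim B_red`, used
as the `SimpleProd` code of the dimension counter-vocabulary. -/
noncomputable def dimSum {J : Type} [Fintype J] (Φ : J → Finset G) : ℕ :=
  ∑ k, Nat.card G / (2 * Nat.card (rstab (Φ k)))

/-- In the `IsEmpty`-coded vocabularies, `HC` of the fattened product (`card (Σ i, Fin |rstab (T i)|) = 0`)
forces the family to be empty (every stabiliser has at least one element). -/
theorem isEmpty_of_card_sigma_eq_zero {ι : Type} [Fintype ι] (T : ι → Finset G)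
    (h : Fintype.card (Σ i : ι, Fin (Fintype.card (rstab (T i)))) = 0) : IsEmpty ι :=
  ⟨fun i => (Fintype.card_eq_zero_iff.1 h).false ⟨i, ⟨0, Fintype.card_pos⟩⟩⟩

/-! ### The eight independence theorems for `ProdClauses` -/

/-- **BMM Cor 2 is load-bearing** in the reduction-free route. -/
theorem prod_bmm_independent (p n : ℕ) (hn : n ≤ p) (hr : ¬ (p < 3 * n ∧ 3 * n < 2 * p)) :
    ∃ V : Vocab G c, (∀ k, V.Meng2019_Lemma4_1_codim k) ∧ V.DR2015_Lemma3_5 ∧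
      (∀ q, V.Liu2021_Cor4_20 q) ∧ V.Liu2021_Def4_5_Shimura8_3 ∧ (∀ q, V.RouteC_R5 q) ∧
      V.IsogFactorMult_of_isog_pow ∧ V.WeilLine_Hodge ∧ ¬ V.BMM2016_Cor2 p n ∧
      ∀ {ι : Type} [Fintype ι] (T : ι → Finset G), ¬ V.WeilAlgebraic T := by
  refine ⟨mk (fun _ _ => False) (fun _ _ => True) (fun _ _ => True) (CMChar c) (fun μ : CMChar c => μ.1)
    (fun μ : CMChar c => μ.2) (fun _ _ => True) (fun _ _ _ => True) (fun _ => False) (fun _ => 0),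
    ?_, ?_, ?_, ?_, ?_, ?_, ?_, ?_, ?_⟩
  · intro k X Y _ h; exact h.elim
  · intro Φ hΦ; exact ⟨toChar hΦ, rfl⟩
  · intro q _ μ m; exact ⟨(), trivial⟩
  · intro μ; exact ⟨1, le_rfl, trivial⟩
  · intro q _ J _ _ Φ _ _ _; exact ⟨(0 : ℕ), trivial, trivial⟩
  · intro X Y Z d m _ _ h; exact h
  · intro ι _ _ T _ _ h; exact h.elim
  · intro h; exact h hn hr (0 : ℕ) trivial
  · intro ι _ T h; exact h

/-- **R7 is load-bearing** in the reduction-free route. -/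
theorem prod_meng_independent (p k : ℕ) :
    ∃ V : Vocab G c, V.BMM2016_Cor2 p k ∧ V.DR2015_Lemma3_5 ∧ (∀ q, V.Liu2021_Cor4_20 q) ∧
      V.Liu2021_Def4_5_Shimura8_3 ∧ (∀ q, V.RouteC_R5 q) ∧ V.IsogFactorMult_of_isog_pow ∧
      V.WeilLine_Hodge ∧ ¬ V.Meng2019_Lemma4_1_codim k ∧
      ∀ {ι : Type} [Fintype ι] (T : ι → Finset G), ¬ V.WeilAlgebraic T := by
  refine ⟨mk (fun S _ => S = 0) (fun _ _ => True) (fun S _ => S = 0) (CMChar c) (fun μ : CMChar c => μ.1)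
    (fun μ : CMChar c => μ.2) (fun _ _ => True) (fun _ _ _ => True) (fun _ => False) (fun _ => 1),
    ?_, ?_, ?_, ?_, ?_, ?_, ?_, ?_, ?_⟩
  · intro _ _ S hS; exact hS
  · intro Φ hΦ; exact ⟨toChar hΦ, rfl⟩
  · intro q _ μ m; exact ⟨(), trivial⟩
  · intro μ; exact ⟨1, le_rfl, trivial⟩
  · intro q _ J _ _ Φ _ _ _; exact ⟨(0 : ℕ), rfl, trivial⟩
  · intro X Y Z d m _ _ h; exact h
  · intro ι _ _ T _ _ h; exact absurd h one_ne_zero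
  · intro h; exact one_ne_zero (h (0 : ℕ) (1 : ℕ) trivial rfl)
  · intro ι _ T h; exact h

/-- **DR Lemma 3.5 is load-bearing** in the reduction-free route. -/
theorem prod_dr_independent (p k : ℕ) {Φ₀ : Finset G} (hΦ₀ : IsCMType c Φ₀) :
    ∃ V : Vocab G c, V.BMM2016_Cor2 p k ∧ (∀ j, V.Meng2019_Lemma4_1_codim j) ∧
      (∀ q, V.Liu2021_Cor4_20 q) ∧ V.Liu2021_Def4_5_Shimura8_3 ∧ (∀ q, V.RouteC_R5 q) ∧
      V.IsogFactorMult_of_isog_pow ∧ V.WeilLine_Hodge ∧ ¬ V.DR2015_Lemma3_5 ∧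
      ∀ {ι : Type} [Fintype ι] [Nonempty ι] (T : ι → Finset G), ¬ V.WeilAlgebraic T := by
  refine ⟨mk (fun S _ => S = 0) (fun _ Y => Y = 0) (fun S _ => S = 0) PEmpty PEmpty.elim
    (fun μ => μ.elim) (fun _ _ => True) (fun _ _ _ => False) (fun {ι} _ _ => IsEmpty ι)
    (fun {J} _ _ _ => Fintype.card J),
    ?_, ?_, ?_, ?_, ?_, ?_, ?_, ?_, ?_⟩
  · intro _ _ S hS; exact hS
  · intro j X Y hXY _; exact hXY
  · intro q _ μ; exact μ.elim
  · intro μ; exact μ.elim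
  · intro q _ J _ _ Φ _ halb _
    by_cases hJ : Nonempty J
    · obtain ⟨k₀⟩ := hJ
      obtain ⟨_, h⟩ := halb k₀ 0
      exact h.elim
    · refine ⟨(0 : ℕ), rfl, ?_⟩
      show Fintype.card J = 0
      rw [Fintype.card_eq_zero_iff]; exact not_nonempty_iff.1 hJ
  · intro X Y Z d m _ _ h; exact h.elim
  · intro ι _ _ T _ _ h; exact isEmpty_of_card_sigma_eq_zero T h
  · intro h; obtain ⟨μ, _⟩ := h Φ₀ hΦ₀; exact μ.elim
  · intro ι _ _ T h; exact h.false (Classical.arbitrary ι)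

/-- **Liu Cor 4.20 is load-bearing** in the reduction-free route. -/
theorem prod_liu_independent (p k : ℕ) (hp : 3 ≤ p + 1) {Φ₀ : Finset G} (hΦ₀ : IsCMType c Φ₀) :
    ∃ V : Vocab G c, V.BMM2016_Cor2 p k ∧ (∀ j, V.Meng2019_Lemma4_1_codim j) ∧ V.DR2015_Lemma3_5 ∧
      V.Liu2021_Def4_5_Shimura8_3 ∧ (∀ q, V.RouteC_R5 q) ∧ V.IsogFactorMult_of_isog_pow ∧
      V.WeilLine_Hodge ∧ ¬ V.Liu2021_Cor4_20 p ∧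
      ∀ {ι : Type} [Fintype ι] [Nonempty ι] (T : ι → Finset G), ¬ V.WeilAlgebraic T := by
  refine ⟨mk (fun S _ => S = 0) (fun _ Y => Y = 0) (fun S _ => S = 0) (CMChar c) (fun μ : CMChar c => μ.1)
    (fun μ : CMChar c => μ.2) (fun _ _ => True) (fun _ _ _ => False) (fun {ι} _ _ => IsEmpty ι)
    (fun {J} _ _ _ => Fintype.card J),
    ?_, ?_, ?_, ?_, ?_, ?_, ?_, ?_, ?_⟩
  · intro _ _ S hS; exact hS
  · intro j X Y hXY _; exact hXY
  · intro Φ hΦ; exact ⟨toChar hΦ, rfl⟩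
  · intro μ; exact ⟨1, le_rfl, trivial⟩
  · intro q _ J _ _ Φ _ halb _
    by_cases hJ : Nonempty J
    · obtain ⟨k₀⟩ := hJ
      obtain ⟨_, h⟩ := halb k₀ 0
      exact h.elim
    · refine ⟨(0 : ℕ), rfl, ?_⟩
      show Fintype.card J = 0
      rw [Fintype.card_eq_zero_iff]; exact not_nonempty_iff.1 hJ
  · intro X Y Z d m _ _ h; exact h.elim
  · intro ι _ _ T _ _ h; exact isEmpty_of_card_sigma_eq_zero T h
  · intro h; obtain ⟨_, h'⟩ := h hp (toChar hΦ₀) 0; exact h'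
  · intro ι _ _ T h; exact h.false (Classical.arbitrary ι)

/-- **Liu Def 4.5 + Shimura §8.3 is load-bearing** in the reduction-free route. -/
theorem prod_liuShimura_independent (p k : ℕ) {Φ₀ : Finset G} (hΦ₀ : IsCMType c Φ₀) :
    ∃ V : Vocab G c, V.BMM2016_Cor2 p k ∧ (∀ j, V.Meng2019_Lemma4_1_codim j) ∧ V.DR2015_Lemma3_5 ∧
      (∀ q, V.Liu2021_Cor4_20 q) ∧ (∀ q, V.RouteC_R5 q) ∧ V.IsogFactorMult_of_isog_pow ∧
      V.WeilLine_Hodge ∧ ¬ V.Liu2021_Def4_5_Shimura8_3 ∧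
      ∀ {ι : Type} [Fintype ι] [Nonempty ι] (T : ι → Finset G), ¬ V.WeilAlgebraic T := by
  refine ⟨mk (fun S _ => S = 0) (fun _ Y => Y = 0) (fun S _ => S = 0) (CMChar c) (fun μ : CMChar c => μ.1)
    (fun μ : CMChar c => μ.2) (fun _ _ => False) (fun _ Y _ => Y = 7) (fun {ι} _ _ => IsEmpty ι)
    (fun {J} _ _ _ => Fintype.card J),
    ?_, ?_, ?_, ?_, ?_, ?_, ?_, ?_, ?_⟩
  · intro _ _ S hS; exact hS
  · intro j X Y hXY _; exact hXY
  · intro Φ hΦ; exact ⟨toChar hΦ, rfl⟩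
  · intro q _ μ m; exact ⟨(), rfl⟩
  · intro q _ J _ _ Φ _ halb _
    by_cases hJ : Nonempty J
    · obtain ⟨k₀⟩ := hJ
      obtain ⟨_, h⟩ := halb k₀ 0
      exact absurd h (show ¬ ((3 : ℕ) = 7) by norm_num)
    · refine ⟨(0 : ℕ), rfl, ?_⟩
      show Fintype.card J = 0
      rw [Fintype.card_eq_zero_iff]; exact not_nonempty_iff.1 hJ
  · intro X Y Z d m _ h; exact h.elim
  · intro ι _ _ T _ _ h; exact isEmpty_of_card_sigma_eq_zero T h
  · intro h; obtain ⟨d, _, h'⟩ := h (toChar hΦ₀); exact h'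
  · intro ι _ _ T h; exact h.false (Classical.arbitrary ι)

/-- **R5 is load-bearing** in the reduction-free route (witnessed by any family of CM types of total
dimension `≤ p`, e.g. the fattened family of a `SumP` family with `|ι| · |G| / 2 ≤ p`). -/
theorem prod_r5_independent (p k : ℕ) (h0 : 4 ≤ Nat.card G) {J : Type} [Fintype J] [DecidableEq J]
    (Φ : J → Finset G) (hΦ : ∀ j, IsCMType c (Φ j))
    (hg : (∑ j, Nat.card G / (2 * Nat.card (rstab (Φ j)))) ≤ p) :
    ∃ V : Vocab G c, V.BMM2016_Cor2 p k ∧ (∀ j, V.Meng2019_Lemma4_1_codim j) ∧ V.DR2015_Lemma3_5 ∧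
      (∀ q, V.Liu2021_Cor4_20 q) ∧ V.Liu2021_Def4_5_Shimura8_3 ∧ V.IsogFactorMult_of_isog_pow ∧
      V.WeilLine_Hodge ∧ ¬ V.RouteC_R5 p ∧
      ∀ {ι : Type} [Fintype ι] (T : ι → Finset G), ¬ V.WeilAlgebraic T := by
  refine ⟨mk (fun _ _ => False) (fun _ _ => True) (fun _ _ => False) (CMChar c) (fun μ : CMChar c => μ.1)
    (fun μ : CMChar c => μ.2) (fun _ _ => True) (fun _ _ _ => True) (fun _ => False) (fun _ => 0),
    ?_, ?_, ?_, ?_, ?_, ?_, ?_, ?_, ?_⟩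
  · intro _ _ S hS; exact hS.elim
  · intro j X Y _ h; exact h.elim
  · intro Φ' hΦ'; exact ⟨toChar hΦ', rfl⟩
  · intro q _ μ m; exact ⟨(), trivial⟩
  · intro μ; exact ⟨1, le_rfl, trivial⟩
  · intro X Y Z d m _ _ h; exact h
  · intro ι _ _ T _ _ h; exact h.elim
  · intro h
    obtain ⟨S, hS, _⟩ := h h0 Φ hΦ (fun j m => ⟨(), trivial⟩) hg
    exact hS
  · intro ι _ T h; exact h

/-- **The isogeny bookkeeping is load-bearing** in the reduction-free route. -/
theorem prod_isog_independent (p k : ℕ) :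
    ∃ V : Vocab G c, V.BMM2016_Cor2 p k ∧ (∀ j, V.Meng2019_Lemma4_1_codim j) ∧ V.DR2015_Lemma3_5 ∧
      (∀ q, V.Liu2021_Cor4_20 q) ∧ V.Liu2021_Def4_5_Shimura8_3 ∧ (∀ q, V.RouteC_R5 q) ∧
      V.WeilLine_Hodge ∧ ¬ V.IsogFactorMult_of_isog_pow ∧
      ∀ {ι : Type} [Fintype ι] [Nonempty ι] (T : ι → Finset G), ¬ V.WeilAlgebraic T := by
  refine ⟨mk (fun S _ => S = 0) (fun _ Y => Y = 0) (fun S _ => S = 0) (CMChar c) (fun μ : CMChar c => μ.1)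
    (fun μ : CMChar c => μ.2) (fun _ _ => True) (fun _ Y _ => Y = 7) (fun {ι} _ _ => IsEmpty ι)
    (fun {J} _ _ _ => Fintype.card J),
    ?_, ?_, ?_, ?_, ?_, ?_, ?_, ?_, ?_⟩
  · intro _ _ S hS; exact hS
  · intro j X Y hXY _; exact hXY
  · intro Φ hΦ; exact ⟨toChar hΦ, rfl⟩
  · intro q _ μ m; exact ⟨(), rfl⟩
  · intro μ; exact ⟨1, le_rfl, trivial⟩
  · intro q _ J _ _ Φ _ halb _
    by_cases hJ : Nonempty J
    · obtain ⟨k₀⟩ := hJ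
      obtain ⟨_, h⟩ := halb k₀ 0
      exact absurd h (show ¬ ((3 : ℕ) = 7) by norm_num)
    · refine ⟨(0 : ℕ), rfl, ?_⟩
      show Fintype.card J = 0
      rw [Fintype.card_eq_zero_iff]; exact not_nonempty_iff.1 hJ
  · intro ι _ _ T _ _ h; exact isEmpty_of_card_sigma_eq_zero T h
  · intro h
    have := h (0 : ℕ) (7 : ℕ) (3 : ℕ) 1 0 le_rfl trivial rfl
    exact absurd this (show ¬ ((3 : ℕ) = 7) by norm_num)
  · intro ι _ _ T h; exact h.false (Classical.arbitrary ι)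

/-- A conjugate pair `(Φ₀, Φ̄₀)` is a `SumP 1` family: every embedding lies in exactly one of the two. -/
theorem sumP_one_pair (hc : IsComplexConj c) {Φ₀ : Finset G} (hΦ₀ : IsCMType c Φ₀) :
    SumP 1 ![Φ₀, c • Φ₀] := by
  intro x
  rw [Finset.card_filter, Fin.sum_univ_two]
  simp only [Matrix.cons_val_zero, Matrix.cons_val_one, hΦ₀.smul_eq_compl hc, Finset.mem_compl]
  by_cases h : x ∈ Φ₀ <;> simp [h]

/-- **The Weil-line clause is load-bearing**: HC holds everywhere, every other clause holds, but no Weil line is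
algebraic — the conjugate pair `(Φ₀, Φ̄₀)` (a divisor class, `SumP 1`) exhibits the failure. -/
theorem prod_weil_independent (hc : IsComplexConj c) (p k : ℕ) {Φ₀ : Finset G} (hΦ₀ : IsCMType c Φ₀) :
    ∃ V : Vocab G c, V.BMM2016_Cor2 p k ∧ (∀ j, V.Meng2019_Lemma4_1_codim j) ∧ V.DR2015_Lemma3_5 ∧
      (∀ q, V.Liu2021_Cor4_20 q) ∧ V.Liu2021_Def4_5_Shimura8_3 ∧ (∀ q, V.RouteC_R5 q) ∧
      V.IsogFactorMult_of_isog_pow ∧ ¬ V.WeilLine_Hodge ∧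
      ∀ {ι : Type} [Fintype ι] (T : ι → Finset G), ¬ V.WeilAlgebraic T := by
  refine ⟨mk (fun _ _ => True) (fun _ _ => True) (fun _ _ => True) (CMChar c) (fun μ : CMChar c => μ.1)
    (fun μ : CMChar c => μ.2) (fun _ _ => True) (fun _ _ _ => True) (fun _ => False) (fun _ => 0),
    ?_, ?_, ?_, ?_, ?_, ?_, ?_, ?_, ?_⟩
  · intro _ _ S _; trivial
  · intro j X Y _ _; trivial
  · intro Φ hΦ; exact ⟨toChar hΦ, rfl⟩
  · intro q _ μ m; exact ⟨(), trivial⟩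
  · intro μ; exact ⟨1, le_rfl, trivial⟩
  · intro q _ J _ _ Φ _ _ _; exact ⟨(0 : ℕ), trivial, trivial⟩
  · intro X Y Z d m _ _ h; exact h
  · intro h
    have hT : ∀ i, IsCMType c (![Φ₀, c • Φ₀] i) := by
      intro i; fin_cases i
      · exact hΦ₀
      · exact hΦ₀.conj hc
    exact h ![Φ₀, c • Φ₀] hT (by simpa using sumP_one_pair hc hΦ₀) trivial
  · intro ι _ T h; exact h

/-! ### The two numerical hypotheses are load-bearing -/

/-- **The dimension bound `g = |ι| · |G| / 2 ≤ p` is load-bearing**: for a `SumP` family `T` of CM types with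
`|ι| · |G| / 2 > p` there is a vocabulary in which ALL EIGHT clauses hold at `(p, k)` — `HC X k` is «`X` has
dimension `≤ p`», the ball quotient is `0`, a product is its dimension, a surjection is the implication of the
dimension bounds — and `W_F(B)` is NOT algebraic.  So the reduction-free route cannot run below `p = dim B`:
Lemma R's contribution on a face is exactly the drop from `dim B` to `dim B_red`. -/
theorem dim_load_bearing (hc : IsComplexConj c) (p k : ℕ) {ι : Type} [Fintype ι] (T : ι → Finset G)
    (hT : ∀ i, IsCMType c (T i)) (hg : p < Fintype.card ι * (Fintype.card G / 2)) :
    ∃ V : Vocab G c, V.ProdClauses p k ∧ ¬ V.WeilAlgebraic T := by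
  refine ⟨mk (fun X _ => X ≤ p) (fun X Y => X ≤ p → Y ≤ p) (fun S _ => S = 0) (CMChar c)
    (fun μ : CMChar c => μ.1) (fun μ : CMChar c => μ.2) (fun _ _ => True) (fun _ _ _ => True)
    (fun {ι'} _ T' => dimSum (fatten T') ≤ p) (fun {J} _ _ Φ => dimSum Φ), ⟨?_, ?_, ?_, ?_, ?_, ?_, ?_, ?_⟩, ?_⟩
  · intro _ _ S hS; subst hS; exact Nat.zero_le p
  · intro X Y hXY hX; exact hXY hX
  · intro Φ hΦ; exact ⟨toChar hΦ, rfl⟩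
  · intro _ μ m; exact ⟨(), trivial⟩
  · intro μ; exact ⟨1, le_rfl, trivial⟩
  · intro _ J _ _ Φ _ _ hΦg; exact ⟨(0 : ℕ), rfl, fun _ => hΦg⟩
  · intro X Y Z d m _ _ h; exact h
  · intro ι' _ _ T' _ _ h; exact h
  · show ¬ (dimSum (fatten T) ≤ p)
    unfold dimSum
    rw [sum_fatten_dim hc hT]
    exact not_le.2 hg

/-- **On a rank-four face, the reduction-free route needs `p ≥ 2 |G|`**: below it (`p < 2 |G|`) all eight clauses of
`ProdClauses p 2` can hold with the face's Weil line not algebraic, whereas with Lemma R `Clauses p 2` discharges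
the face as soon as `p ≥ max (6, dim B_red)` (`FaceData.weilAlgebraic`; e.g. `p = 6` on the sealed sixfold
`A × E × E′`, `RouteCFaceC2C2C2Discharge`, where `2 |G| = 16`).  Lemma R is worth exactly `dim B − dim B_red`. -/
theorem face_needs_lemmaR_below_two_card (hc : IsComplexConj c) {Φ : Finset G} (hΦ : IsCMType c Φ)
    (π π' : G) {p : ℕ} (hp : p < 2 * Fintype.card G) :
    ∃ V : Vocab G c, V.ProdClauses p 2 ∧ ¬ V.WeilAlgebraic (faceCorners c Φ π π') := by
  refine dim_load_bearing hc p 2 (faceCorners c Φ π π') (isCMType_faceCorners hc hΦ π π') ?_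
  obtain ⟨q, hq⟩ : 2 ∣ Fintype.card G := ⟨Φ.card, (hΦ.two_mul_card hc).symm⟩
  simp only [Fintype.card_fin, hq, Nat.mul_div_cancel_left _ two_pos] at hp ⊢
  omega

/-- **BMM's range `3k ≤ p` is load-bearing**: for `p < 3k < 2p` (inside the excluded interval `]p/3, 2p/3[`) there is
a vocabulary satisfying all eight clauses at `(p, k)` — BMM Cor 2 vacuous, nothing HC — in which no Weil line is
algebraic. -/
theorem range_load_bearing (p k : ℕ) (hr : p < 3 * k ∧ 3 * k < 2 * p) :
    ∃ V : Vocab G c, V.ProdClauses p k ∧ ∀ {ι : Type} [Fintype ι] (T : ι → Finset G), ¬ V.WeilAlgebraic T := by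
  refine ⟨mk (fun _ _ => False) (fun _ _ => True) (fun _ _ => True) (CMChar c) (fun μ : CMChar c => μ.1)
    (fun μ : CMChar c => μ.2) (fun _ _ => True) (fun _ _ _ => True) (fun _ => False) (fun _ => 0),
    ⟨?_, ?_, ?_, ?_, ?_, ?_, ?_, ?_⟩, ?_⟩
  · intro _ hnr; exact absurd hr hnr
  · intro X Y _ h; exact h.elim
  · intro Φ hΦ; exact ⟨toChar hΦ, rfl⟩
  · intro _ μ m; exact ⟨(), trivial⟩
  · intro μ; exact ⟨1, le_rfl, trivial⟩
  · intro _ J _ _ Φ _ _ _; exact ⟨(0 : ℕ), trivial, trivial⟩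
  · intro X Y Z d m _ _ h; exact h
  · intro ι _ _ T _ _ h; exact h.elim
  · intro ι _ T h; exact h

end LoadBearing

end HodgeRepro.RouteC
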